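import Literature.NumberTheory.Sieve.BombieriAsymptoticSieveLemmata
import HarnessLib

/-!
# Bombieri's asymptotic sieve: sieve dimension and subsequences of a Bombieri sequence

Topic `Literature/NumberTheory/Sieve`, companion ("Proofs") file of `BombieriAsymptoticSieve.lean`
([BombieriRIMS1977]; [FriedlanderIwaniecPisa1978] §4). Preparations for [FriedlanderIwaniecPisa1978]
Lemmata 11–12, where the fundamental lemma (`SieveSequence.fundamental_lemma_uniform`) is applied
to the subsequences `𝒜_e = {a_n : e ∣ n}` (`SieveSequence.restrictDvd`) for `e` coprime to
`P(z)` (p. 738: "By Lemma 5 we get `∑_{n ≤ x, (n,P(z))=1, n ≡ 0 (mod d)} a_n ≤ … ≪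
A(x) f(d)⁻¹ ∏_{p ∣ P(z)} (1 − 1/f(p)) + ∑_{ν ∣ P(z), ν ≤ z²} |R(x, νd)|`"). All PROVED:

* `density_nonneg_or_size_eq_zero` — under (A₁)–(A₅) either `g(d) ≥ 0` for all `d ≥ 1` or
  `A(x) = 0` for all `x` (a negative `g(d)` would make `R(x; d) ≥ |g(d)| A(x)`, against (A₂));
  Bombieri's (A₁) [BombieriRIMS1977] does not state `g ≥ 0`, Friedlander–Iwaniec's does (p. 719,
  `f(d) > 1`);
* `hasSieveDimension` — in the non-degenerate case `g` has sieve dimension `κ = 1`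
  (`HasSieveDimension g 1 K`), by Lemma 7 (`densityProduct_bounds`) and Mertens;
* `sifted_restrictDvd`, `remainder_restrictDvd` — `S(𝒜_e, P; x) = ∑_{n ≤ x, (n,P)=1, e ∣ n} a_n` and
  `R'_d(x) = R(x; ed)` for `(e, d) = 1`;
* `densityProduct_primesProdBelow`, `primesBelow_filter_ge_eq_sdiff` — bookkeeping for `V(z)`;
* `sum_coprime_sum_divisors_le` — the rearrangement `∑_{m ∈ M} ∑_{d ∣ P, d ≤ D} f(md) ≤ ∑_{q < L} f(q)`
  for rough `m` with `m D < L` (`(m, d) ↦ md` is injective), which brings (A₂) to bear on the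
  remainders `R(x, νd)` of the subsequences (pp. 738–739).
-/

noncomputable section

open Filter Finset
open scoped Topology

namespace Literature.NumberTheory.Sieve

namespace BombieriSieve

/-! ### Positivity of the density, or degeneracy -/

/-- **Dichotomy.** For a sequence satisfying Bombieri's (A₁)–(A₅), either the density is
nonnegative, `g(d) ≥ 0` for all `d ≥ 1`, or the sequence is empty in the sense that
`A(x) = ∑_{m ≤ x} a_m = 0` for every `x`. Indeed if `A(x₀) > 0` and `g(d) < 0` then
`R(x; d) = A(x; d) − g(d) A(x) ≥ |g(d)| A(x) ≥ |g(d)| A(x₀) > 0`-proportion of `A(x)` for all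
`x ≥ x₀`, contradicting (A₂) (with `ε = ½`, `B = 1`: `|R(x; d)| ≤ C A(x)/log x` for `x > d²`
large). (Bombieri's (A₁) [BombieriRIMS1977] only asks `1/f(d) < 1`; Friedlander–Iwaniec's (A₁)
has `f(d) > 1`, i.e. `0 < g(d) < 1`, [FriedlanderIwaniecPisa1978] p. 719.) [folklore] -/
theorem density_nonneg_or_size_eq_zero (A : SieveSequence) (hA : A.IsBombieriSequence) :
    (∀ d : ℕ, 1 ≤ d → 0 ≤ A.density d) ∨ ∀ x : ℝ, A.size x = 0 := by
  by_contra h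
  rw [not_or, not_forall, not_forall] at h
  obtain ⟨⟨d, hd⟩, ⟨x₀, hx₀⟩⟩ := h
  rw [Classical.not_imp, not_le] at hd
  obtain ⟨hd1, hgd⟩ := hd
  obtain ⟨hsize, -, h2, -⟩ := hA
  -- `A(x) ≥ A(x₀) > 0` for `x ≥ x₀`
  have hsz_nonneg : ∀ x, 0 ≤ A.size x := SieveSequence.size_nonneg_of_size_eq hsize
  have hpos : 0 < A.size x₀ := lt_of_le_of_ne (hsz_nonneg x₀) (Ne.symm hx₀)
  have hmono : ∀ x, x₀ ≤ x → A.size x₀ ≤ A.size x := by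
    intro x hx
    rw [hsize, hsize, SieveSequence.congrSum, SieveSequence.congrSum]
    exact Finset.sum_le_sum_of_subset_of_nonneg
      (Finset.filter_subset_filter _ (Finset.Ioc_subset_Ioc_right (Nat.floor_le_floor hx)))
      fun n _ _ => A.a_nonneg n
  -- (A₂) with `ε = 1/2`, `B = 1`
  obtain ⟨C, hC⟩ := h2 (1 / 2) one_half_pos 1 one_pos
  have hev : ∀ᶠ x : ℝ in atTop, |A.density d| * A.size x ≤ C * A.size x / Real.log x := by
    filter_upwards [hC, eventually_gt_atTop ((d : ℝ) ^ 2), eventually_ge_atTop (1 : ℝ)]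
      with x hx hxd hx1
    have hsel := hx (fun _ => x) fun _ => le_rfl
    have hx0 : 0 < x := by linarith
    -- the term `d` lies in the range `d < x^{1/2}`
    have hdmem : d ∈ Finset.Ico 1 ⌈x ^ (1 - 1 / 2 : ℝ)⌉₊ := by
      rw [Finset.mem_Ico]
      refine ⟨hd1, Nat.lt_ceil.mpr ?_⟩
      rw [show (1 - 1 / 2 : ℝ) = 1 / 2 by norm_num, ← Real.sqrt_eq_rpow]
      rw [Real.lt_sqrt (by positivity)]
      exact hxd
    have hterm : |A.remainder d x| ≤ C * A.size x / Real.log x ^ (1 : ℝ) :=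
      le_trans (Finset.single_le_sum (f := fun i => |A.remainder i x|) (fun _ _ => abs_nonneg _)
        hdmem) hsel
    rw [Real.rpow_one] at hterm
    refine le_trans ?_ hterm
    -- `|g d| A(x) ≤ |R(x; d)|` since `R = A_d − g A ≥ −g A = |g| A`
    have hR : A.remainder d x = A.congrSum d x - A.density d * A.size x := rfl
    have hcs : 0 ≤ A.congrSum d x := Finset.sum_nonneg fun n _ => A.a_nonneg n
    rw [abs_of_neg hgd]
    calc -A.density d * A.size x ≤ A.remainder d x := by rw [hR]; linarith
      _ ≤ |A.remainder d x| := le_abs_self _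
  -- choose `x` large: `x ≥ x₀`, `x > 1`, `log x > C / |g d| + 1`
  have hgd' : 0 < |A.density d| := abs_pos.mpr hgd.ne
  obtain ⟨x, hx, hxx₀, hx1, hxlog⟩ := (hev.and ((eventually_ge_atTop x₀).and
    ((eventually_gt_atTop (1 : ℝ)).and
      (Real.tendsto_log_atTop.eventually_gt_atTop (C / |A.density d| + 1))))).exists
  have hAx : 0 < A.size x := lt_of_lt_of_le hpos (hmono x hxx₀)
  have hlogpos : 0 < Real.log x := Real.log_pos hx1
  have key : |A.density d| * A.size x ≤ C * A.size x / Real.log x := hx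
  -- divide by `A(x) > 0`: `|g d| ≤ C / log x`, i.e. `|g d| log x ≤ C`
  have h1 : |A.density d| * Real.log x ≤ C := by
    have := key
    rw [le_div_iff₀ hlogpos] at this
    nlinarith
  have h2 : C < |A.density d| * Real.log x := by
    have := hxlog
    have h3 : C / |A.density d| < Real.log x := by linarith
    rwa [div_lt_iff₀ hgd', mul_comm] at h3
  linarith

/-! ### The subsequences `𝒜_e` (`SieveSequence.restrictDvd`) for `e` coprime to the sifting range -/

/-- `S(𝒜_e, P; x) = ∑_{n ≤ x, (n, P) = 1, e ∣ n} a_n` (unfolding `SieveSequence.restrictDvd`).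
[folklore] -/
theorem sifted_restrictDvd (A : SieveSequence) (e : ℕ) (x : ℝ) (P : ℕ) :
    (A.restrictDvd e).sifted x P =
      ∑ n ∈ (Ioc 0 ⌊x⌋₊).filter (fun n : ℕ => n.Coprime P ∧ e ∣ n), A.a n := by
  rw [SieveSequence.sifted]
  simp only [SieveSequence.restrictDvd_a]
  rw [Finset.sum_ite, Finset.sum_const_zero, add_zero, Finset.filter_filter]

/-- `R'_d(x) = R(x; ed)` for the subsequence `𝒜_e` (size `g(e) X(x)`, density `g`) and `(e, d) = 1`:
`(𝒜_e)_d(x) = 𝒜_{ed}(x)` (`restrictDvd_congrSum`) and `g(ed) = g(e) g(d)`. [folklore] -/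
theorem remainder_restrictDvd (A : SieveSequence) {e d : ℕ} (hed : e.Coprime d) (x : ℝ) :
    (A.restrictDvd e).remainder d x = A.remainder (e * d) x := by
  rw [SieveSequence.remainder, SieveSequence.remainder, SieveSequence.restrictDvd_congrSum A hed,
    A.density_mult.map_mul_of_coprime hed]
  show A.congrSum (e * d) x - A.density d * (A.density e * A.size x) =
    A.congrSum (e * d) x - A.density e * A.density d * A.size x
  ring

/-- `V(z) = ∏_{p < z} (1 − g(p))` over `Nat.primesBelow ⌈z⌉₊`. [folklore] -/
theorem densityProduct_primesProdBelow (A : SieveSequence) (z : ℝ) :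
    A.densityProduct (primesProdBelow z) = ∏ p ∈ Nat.primesBelow ⌈z⌉₊, (1 - A.density p) := by
  rw [SieveSequence.densityProduct, primeFactors_primesProdBelow]

/-- Splitting the primes `< z` at `w ≤ z`: those `< w` and the window `w ≤ p < z`. [folklore] -/
theorem primesBelow_filter_ge_eq_sdiff {w z : ℝ} :
    (Nat.primesBelow ⌈z⌉₊).filter (fun p : ℕ => w ≤ (p : ℝ)) =
      Nat.primesBelow ⌈z⌉₊ \ Nat.primesBelow ⌈w⌉₊ := by
  ext p
  simp only [Finset.mem_filter, Finset.mem_sdiff, Nat.mem_primesBelow, Nat.lt_ceil, not_and]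
  constructor
  · rintro ⟨⟨hpz, hp⟩, hwp⟩
    exact ⟨⟨hpz, hp⟩, fun hlt => absurd hwp (not_le.mpr hlt)⟩
  · rintro ⟨⟨hpz, hp⟩, h⟩
    exact ⟨⟨hpz, hp⟩, le_of_not_gt fun hlt => h hlt hp⟩

/-- **Bombieri sequences have sieve dimension `1`.** If `𝒜` satisfies (A₁)–(A₅) and its density is
nonnegative (the non-degenerate case of `density_nonneg_or_size_eq_zero`), then
`HasSieveDimension g 1 K` for some `K`: by [FriedlanderIwaniecPisa1978] Lemma 7
(`densityProduct_bounds`: `K₀⁻¹ H P(z) ≤ V(z) ≤ K₀ H P(z)`, `P(z) = ∏_{p<z}(1 − 1/p)`) and Mertens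
(`prod_primesGe_one_sub_inv_inv_le`: `∏_{w ≤ p ≤ z}(1 − 1/p)⁻¹ ≤ e⁵ log z/log w`),
`∏_{w ≤ p < z} (1 − g(p))⁻¹ = V(w)/V(z) ≤ K₀² e⁵ log z / log w`. [folklore] -/
theorem hasSieveDimension (A : SieveSequence) (hA : A.IsBombieriSequence)
    (hg : ∀ d : ℕ, 1 ≤ d → 0 ≤ A.density d) : ∃ K : ℝ, HasSieveDimension A.density 1 K := by
  obtain ⟨H, hH, -, K, hK1, hV⟩ := densityProduct_bounds A hA
  have hK0 : 0 < K := by linarith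
  have h1 := hA.2.1
  refine ⟨K * K * Real.exp 5, ⟨fun p hp => ⟨hg p hp.one_lt.le, h1.2 p hp.one_lt⟩, ?_⟩⟩
  intro w z hw hwz
  have hz : 2 ≤ z := hw.trans hwz
  -- positivity of the factors
  have hfac : ∀ p ∈ Nat.primesBelow ⌈z⌉₊, 0 < 1 - A.density p := fun p hp =>
    sub_pos.mpr (h1.2 p (Nat.prime_of_mem_primesBelow hp).one_lt)
  have hsub : Nat.primesBelow ⌈w⌉₊ ⊆ Nat.primesBelow ⌈z⌉₊ :=
    Nat.primesBelow_mono (Nat.ceil_mono hwz)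
  -- `V(z) = V(w) · Vwin`, `P(z) = P(w) · Pwin`
  set Vwin := ∏ p ∈ (Nat.primesBelow ⌈z⌉₊).filter (fun p : ℕ => w ≤ (p : ℝ)), (1 - A.density p)
    with hVwin
  set Pwin := ∏ p ∈ (Nat.primesBelow ⌈z⌉₊).filter (fun p : ℕ => w ≤ (p : ℝ)), (1 - (p : ℝ)⁻¹)
    with hPwin
  have hsplit : A.densityProduct (primesProdBelow z) = A.densityProduct (primesProdBelow w) * Vwin := by
    rw [densityProduct_primesProdBelow, densityProduct_primesProdBelow, hVwin,
      primesBelow_filter_ge_eq_sdiff, mul_comm, Finset.prod_sdiff hsub]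
  have hsplit₁ : ∏ p ∈ Nat.primesBelow ⌈z⌉₊, (1 - (p : ℝ)⁻¹) =
      (∏ p ∈ Nat.primesBelow ⌈w⌉₊, (1 - (p : ℝ)⁻¹)) * Pwin := by
    rw [hPwin, primesBelow_filter_ge_eq_sdiff, mul_comm, Finset.prod_sdiff hsub]
  have hVwin_pos : 0 < Vwin := Finset.prod_pos fun p hp => hfac p (Finset.mem_filter.mp hp).1
  have hPwin_pos : 0 < Pwin := Finset.prod_pos fun p hp =>
    sub_pos.mpr (inv_lt_one_of_one_lt₀ (by
      exact_mod_cast (Nat.prime_of_mem_primesBelow (Finset.mem_filter.mp hp).1).one_lt))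
  have hPwpos : 0 < ∏ p ∈ Nat.primesBelow ⌈w⌉₊, (1 - (p : ℝ)⁻¹) := Finset.prod_pos fun p hp =>
    sub_pos.mpr (inv_lt_one_of_one_lt₀ (by
      exact_mod_cast (Nat.prime_of_mem_primesBelow hp).one_lt))
  -- the product of inverses is `Vwin⁻¹`
  have hinv : ∏ p ∈ (Nat.primesBelow ⌈z⌉₊).filter (fun p : ℕ => w ≤ (p : ℝ)), (1 - A.density p)⁻¹ =
      Vwin⁻¹ := by
    rw [hVwin, Finset.prod_inv_distrib]
  rw [hinv, Real.rpow_one]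
  -- `Vwin ≥ K⁻² Pwin`: from `V(z) ≥ K⁻¹ H P(z)` and `V(w) ≤ K H P(w)`
  obtain ⟨hzlo, -⟩ := hV z hz
  obtain ⟨-, hwhi⟩ := hV w hw
  rw [hsplit] at hzlo
  rw [hsplit₁] at hzlo
  -- hzlo : K⁻¹ * (H * (Pw * Pwin)) ≤ V(w) * Vwin,  hwhi : V(w) ≤ K * (H * Pw)
  have hVw0 : 0 ≤ A.densityProduct (primesProdBelow w) := by
    rw [densityProduct_primesProdBelow]
    exact Finset.prod_nonneg fun p hp => (hfac p (hsub hp)).le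
  have hkey : K⁻¹ * (H * ((∏ p ∈ Nat.primesBelow ⌈w⌉₊, (1 - (p : ℝ)⁻¹)) * Pwin)) ≤
      K * (H * ∏ p ∈ Nat.primesBelow ⌈w⌉₊, (1 - (p : ℝ)⁻¹)) * Vwin :=
    hzlo.trans (mul_le_mul_of_nonneg_right hwhi hVwin_pos.le)
  -- hence Vwin⁻¹ ≤ K² Pwin⁻¹
  have hVwin_inv : Vwin⁻¹ ≤ K * K * Pwin⁻¹ := by
    rw [inv_le_iff_one_le_mul₀ hVwin_pos]
    -- from hkey: H Pw Pwin / K ≤ K H Pw Vwin, divide by H Pw > 0: Pwin / K ≤ K Vwin, so 1 ≤ K² Vwin/Pwin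
    have hHP : 0 < H * ∏ p ∈ Nat.primesBelow ⌈w⌉₊, (1 - (p : ℝ)⁻¹) := mul_pos hH hPwpos
    have h2 : Pwin ≤ K * K * Vwin := by
      have h3 : K⁻¹ * Pwin ≤ K * Vwin := by
        have := hkey
        have h4 : K⁻¹ * (H * ((∏ p ∈ Nat.primesBelow ⌈w⌉₊, (1 - (p : ℝ)⁻¹)) * Pwin)) =
            (H * ∏ p ∈ Nat.primesBelow ⌈w⌉₊, (1 - (p : ℝ)⁻¹)) * (K⁻¹ * Pwin) := by ring
        have h5 : K * (H * ∏ p ∈ Nat.primesBelow ⌈w⌉₊, (1 - (p : ℝ)⁻¹)) * Vwin =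
            (H * ∏ p ∈ Nat.primesBelow ⌈w⌉₊, (1 - (p : ℝ)⁻¹)) * (K * Vwin) := by ring
        rw [h4, h5] at this
        exact le_of_mul_le_mul_left this hHP
      have h6 : Pwin = K * (K⁻¹ * Pwin) := by field_simp
      rw [h6, mul_assoc]
      exact mul_le_mul_of_nonneg_left h3 hK0.le
    calc (1 : ℝ) = Pwin⁻¹ * Pwin := by rw [inv_mul_cancel₀ hPwin_pos.ne']
      _ ≤ Pwin⁻¹ * (K * K * Vwin) := mul_le_mul_of_nonneg_left h2 (inv_nonneg.mpr hPwin_pos.le)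
      _ = K * K * Pwin⁻¹ * Vwin := by ring
  -- and `Pwin⁻¹ ≤ ∏_{w ≤ p ≤ z} (1 − 1/p)⁻¹ ≤ e⁵ log z / log w`
  have hPwin_inv : Pwin⁻¹ ≤ Real.exp 5 * Real.log z / Real.log w := by
    rw [hPwin, ← Finset.prod_inv_distrib]
    refine le_trans ?_ (prod_primesGe_one_sub_inv_inv_le hw hwz)
    have hST : (Nat.primesBelow ⌈z⌉₊).filter (fun p : ℕ => w ≤ (p : ℝ)) ⊆
        (Nat.primesLE ⌊z⌋₊).filter (fun p : ℕ => w ≤ (p : ℝ)) := by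
      intro p hp
      rw [Finset.mem_filter] at hp ⊢
      refine ⟨?_, hp.2⟩
      rw [Nat.mem_primesLE]
      have hp' := Nat.mem_primesBelow.mp hp.1
      exact ⟨Nat.le_floor (Nat.lt_ceil.mp hp'.1).le, hp'.2⟩
    have hge1 : ∀ p ∈ (Nat.primesLE ⌊z⌋₊).filter (fun p : ℕ => w ≤ (p : ℝ)),
        (1 : ℝ) ≤ (1 - (p : ℝ)⁻¹)⁻¹ := by
      intro p hp
      have hp1 : (1 : ℝ) < p := by
        exact_mod_cast (Nat.prime_of_mem_primesLE (Finset.mem_filter.mp hp).1).one_lt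
      rw [one_le_inv_iff₀]
      exact ⟨sub_pos.mpr (inv_lt_one_of_one_lt₀ hp1), sub_le_self _ (inv_nonneg.mpr (by linarith))⟩
    rw [← Finset.prod_sdiff hST]
    have h1 : (1 : ℝ) ≤ ∏ p ∈ (Nat.primesLE ⌊z⌋₊).filter (fun p : ℕ => w ≤ (p : ℝ)) \
        (Nat.primesBelow ⌈z⌉₊).filter (fun p : ℕ => w ≤ (p : ℝ)), (1 - (p : ℝ)⁻¹)⁻¹ := by
      calc (1 : ℝ) = ∏ p ∈ (Nat.primesLE ⌊z⌋₊).filter (fun p : ℕ => w ≤ (p : ℝ)) \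
          (Nat.primesBelow ⌈z⌉₊).filter (fun p : ℕ => w ≤ (p : ℝ)), (1 : ℝ) :=
            Finset.prod_const_one.symm
        _ ≤ _ := Finset.prod_le_prod (fun _ _ => zero_le_one)
            fun p hp => hge1 p (Finset.mem_sdiff.mp hp).1
    have h0 : (0 : ℝ) ≤ ∏ p ∈ (Nat.primesBelow ⌈z⌉₊).filter (fun p : ℕ => w ≤ (p : ℝ)),
        (1 - (p : ℝ)⁻¹)⁻¹ :=
      Finset.prod_nonneg fun p hp => zero_le_one.trans (hge1 p (hST hp))
    calc ∏ p ∈ (Nat.primesBelow ⌈z⌉₊).filter (fun p : ℕ => w ≤ (p : ℝ)), (1 - (p : ℝ)⁻¹)⁻¹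
        = 1 * ∏ p ∈ (Nat.primesBelow ⌈z⌉₊).filter (fun p : ℕ => w ≤ (p : ℝ)), (1 - (p : ℝ)⁻¹)⁻¹ :=
          (one_mul _).symm
      _ ≤ _ := mul_le_mul_of_nonneg_right h1 h0
  have hlog : 0 ≤ Real.exp 5 * Real.log z / Real.log w :=
    div_nonneg (mul_nonneg (Real.exp_pos 5).le (Real.log_nonneg (by linarith)))
      (Real.log_nonneg (by linarith))
  calc Vwin⁻¹ ≤ K * K * Pwin⁻¹ := hVwin_inv
    _ ≤ K * K * (Real.exp 5 * Real.log z / Real.log w) :=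
        mul_le_mul_of_nonneg_left hPwin_inv (by positivity)
    _ = K * K * Real.exp 5 * (Real.log z / Real.log w) := by ring

/-! ### Rearranging the remainder terms of the subsequences -/

/-- For `P ≠ 0`, `f ≥ 0`, a finite set `M` of positive integers coprime to `P`, and `m D < L`
for all `m ∈ M`: `∑_{m ∈ M} ∑_{d ∣ P, d ≤ D} f(m d) ≤ ∑_{1 ≤ q < L} f(q)`: the map `(m, d) ↦ m d`
is injective on these pairs (`d = (m d, P)`), with image in `[1, L)`. This is how (A₂) is brought
to bear on the remainders `R(x, ν d)`, `ν ∣ P(z)`, `ν ≤ z²` (resp. `ν ≤ z^s`), `(d, P(z)) = 1`, in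
the proofs of [FriedlanderIwaniecPisa1978] Lemmata 11 and 12 (pp. 738–739: the moduli
`ν d ≤ z² x/y < x^{1−ε}`, resp. `ν d < z^s y ≤ x^{1−ε}`, are distinct). [folklore] -/
theorem sum_coprime_sum_divisors_le {P : ℕ} (hP : P ≠ 0) (f : ℕ → ℝ) (hf : ∀ q, 0 ≤ f q)
    (M : Finset ℕ) (hM : ∀ m ∈ M, m ≠ 0 ∧ m.Coprime P) (D L : ℝ)
    (hL : ∀ m ∈ M, (m : ℝ) * D < L) :
    ∑ m ∈ M, ∑ d ∈ P.divisors.filter (fun d : ℕ => (d : ℝ) ≤ D), f (m * d) ≤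
      ∑ q ∈ Ico 1 ⌈L⌉₊, f q := by
  set Dv := P.divisors.filter (fun d : ℕ => (d : ℝ) ≤ D) with hDv
  have hmemD : ∀ {d : ℕ}, d ∈ Dv → (d ∣ P ∧ d ≠ 0) ∧ (d : ℝ) ≤ D := by
    intro d hd
    obtain ⟨hd', hdD⟩ := Finset.mem_filter.mp hd
    have hdP : d ∣ P := Nat.dvd_of_mem_divisors hd'
    refine ⟨⟨hdP, fun h0 => hP (Nat.eq_zero_of_zero_dvd (h0 ▸ hdP))⟩, hdD⟩
  -- injectivity of `(m, d) ↦ m d`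
  have hinj : Set.InjOn (fun e : ℕ × ℕ => e.1 * e.2) ↑(M ×ˢ Dv) := by
    rintro ⟨m, d⟩ he ⟨m', d'⟩ he' h
    rw [Finset.coe_product, Set.mem_prod, Finset.mem_coe, Finset.mem_coe] at he he'
    obtain ⟨⟨-, hmP⟩, ⟨hdP, hd0⟩, -⟩ := And.intro (hM m he.1) (hmemD he.2)
    obtain ⟨⟨-, hmP'⟩, ⟨hdP', -⟩, -⟩ := And.intro (hM m' he'.1) (hmemD he'.2)
    change m * d = m' * d' at h
    have hd : d = d' := by
      have h1 : Nat.gcd (m * d) P = d := by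
        rw [Nat.Coprime.gcd_mul_left_cancel d hmP]
        exact Nat.gcd_eq_left hdP
      have h2 : Nat.gcd (m' * d') P = d' := by
        rw [Nat.Coprime.gcd_mul_left_cancel d' hmP']
        exact Nat.gcd_eq_left hdP'
      rw [← h1, h, h2]
    subst hd
    have hm : m = m' := Nat.eq_of_mul_eq_mul_right (Nat.pos_of_ne_zero hd0) h
    rw [hm]
  -- the image lies in `[1, L)`
  have himage : (M ×ˢ Dv).image (fun e : ℕ × ℕ => e.1 * e.2) ⊆ Ico 1 ⌈L⌉₊ := by
    intro q hq
    obtain ⟨⟨m, d⟩, he, rfl⟩ := Finset.mem_image.mp hq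
    obtain ⟨hm, hd⟩ := Finset.mem_product.mp he
    obtain ⟨hm0, -⟩ := hM m hm
    obtain ⟨⟨-, hd0⟩, hdD⟩ := hmemD hd
    rw [Finset.mem_Ico]
    refine ⟨Nat.one_le_iff_ne_zero.mpr (Nat.mul_ne_zero hm0 hd0), Nat.lt_ceil.mpr ?_⟩
    push_cast
    calc (m : ℝ) * d ≤ m * D := mul_le_mul_of_nonneg_left hdD (Nat.cast_nonneg m)
      _ < L := hL m hm
  have hprod : ∑ m ∈ M, ∑ d ∈ Dv, f (m * d) = ∑ e ∈ M ×ˢ Dv, f (e.1 * e.2) := by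
    rw [Finset.sum_product]
  rw [hprod, ← Finset.sum_image hinj]
  exact Finset.sum_le_sum_of_subset_of_nonneg himage fun q _ _ => hf q


end BombieriSieve

end Literature.NumberTheory.Sieve
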